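import Summits.AnomalousDissipation.AnomalousDissipation.Theorems.TwodBoundedEnergyZeroMomentum.Negative.FirstShellTrilinear
import Literature.Analysis.FluidPDE.LongTimeAverageNonneg
import Literature.Analysis.FluidPDE.LinearizedNSTorus
import Literature.Analysis.FluidPDE.TorusClassicalLerayHopfProofs

/-!
# General first-shell forces, III: the whole first Stokes eigenspace is rigid for the crux
`TwoAndHalfD.TwodBoundedEnergyZeroMomentum` (stmt-AnomalousDissipation-10786; negative-side
support, cdisprove seat `refuter-cdisprove-stmt-AnomalousDissipation-10786-g2-0`, generation 2)

The crux asks for ONE smooth divergence-free mean-zero steady force `g ≠ 0` on `(UnitAddTorus (Fin 2))` admitting,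
along `ν_j → 0⁺`, zero-momentum global Leray–Hopf solutions with `sup_j ⟨‖v_j‖²⟩ < ∞`.
Generation 1 (`Negative/FirstShellRigidity.lean`) killed the special case `g = marchioroForce α`
(the single Fourier pair `±(1,0)`, via `Marchioro1986_globalAttraction_holds`).  This file kills
the WHOLE FIRST EIGENSPACE — every `g` whose Fourier support lies on the shell `|k|² = 1`
(`span{cos/sin(2πx₀) e₁, cos/sin(2πx₁) e₀}`, crossed cellular forces included) — without going
through the convergence to the laminar state:

* `meanEnergy_ge_of_firstShell` — MAIN LEMMA: for every zero-momentum global Leray–Hopf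
  solution under a first-shell force, `⟨‖u‖²⟩ ≥ ‖g‖₂²/(16π⁴ν²) = ‖g/(νλ₁)‖₂²`.  Test the weak
  formulation with `g` itself (`Δg = -4π²g`): `⟨u(T),g⟩ - ⟨u₀,g⟩ = ∫₀ᵀ (N - 4π²ν⟨u,g⟩ + ‖g‖₂²)`,
  where the trilinear term `N = ∫⟪u,(u·∇)g⟫ → 0` (sibling `FirstShellTrilinear`: its
  first-eigenspace part vanishes by parity and the rest carries a factor `Q₁u → 0` by the decay of
  the enstrophy excess, sibling `FirstShellGalerkin`); hence the Cesàro means of `⟨u,g⟩` tend to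
  `L = ‖g‖₂²/(4π²ν)`, and `‖u‖₂² ≥ ⟨u,g⟩²/‖g‖₂² ≥ (2L⟨u,g⟩ - L²)/‖g‖₂²` gives the floor in the
  `limsup`.
* `not_TwodBoundedEnergyZeroMomentum_firstShell` — the crux WITH ONE EXTRA CONJUNCT (Fourier
  support of `g` on the first shell) is FALSE; `exists_mode_two_le_of_witness` — every witness
  force of the crux has `ĝ(k) ≠ 0` for some `|k|² ≥ 2` (design constraint for provers).
* `integral_norm_sq_ge_of_steady_firstShell`, `not_boundedSteadyBranch_firstShell` — the same
  for smooth zero-mean STEADY states (`Torus.IsSteadyNSState`, the sub-class used by every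
  round-1 crux idea): no bounded steady branch exists under a first-shell force.

All statements are over tree objects only; no new definitions. References: FMRT 2001, Ch. III
§3.1 (3.31)–(3.35), App. III.A.4 (A.32)–(A.34); Marchioro, CMP 105 (1986); Constantin–Tarfulea–
Vicol, arXiv:1305.7089, §1 p. 3 and §2 (the open problem).
-/

noncomputable section

open MeasureTheory Set Filter Topology UnitAddTorus
open scoped ENNReal NNReal InnerProductSpace ComplexConjugate

namespace Summit.AnomalousDissipation.AnomalousDissipation.Theorems.TwodBoundedEnergyZeroMomentum.Negative

open Literature.Analysis.FunctionSpaces Literature.Analysis.FunctionSpaces.Torus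
open Literature.Analysis.FluidPDE Literature.Analysis.FluidPDE.Torus
open Literature.Barriers.AnomalousDissipation


/-! ### The laminar energy is a floor: `⟨‖u‖²⟩ ≥ ‖g‖₂²/(16π⁴ν²)` under every first-shell force -/

section Main

variable {ν : ℝ} {g u₀ : (UnitAddTorus (Fin 2)) → (EuclideanSpace ℝ (Fin 2))} {u : ℝ → (UnitAddTorus (Fin 2)) → (EuclideanSpace ℝ (Fin 2))}

/-- **Mean energy under a general first-shell force is at least the laminar one.** Let `g` be a
smooth, divergence-free, mean-zero force on `(UnitAddTorus (Fin 2))` whose Fourier support lies on the first shell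
`|k|² = 1` (a first eigenfunction of the Stokes operator, `λ₁ = 4π²`; the 4-dimensional
eigenspace of FMRT 2001, Ch. III §3.1, not only the single pair `marchioroForce α`), `ν > 0`,
`u₀ ∈ L²` with zero mean, and `u` ANY global Leray–Hopf solution. Then
`⟨‖u‖²⟩ ≥ ‖g‖₂²/(16π⁴ν²) = ‖g/(νλ₁)‖₂²`.
Proof: by (A.32)–(A.34) (Galerkin level, `exists_lerayHopf_enstrophyExcess_tendsto_zero_of_firstShell`)
and 2-D uniqueness the component of `u(t)` off the first eigenspace tends to `0` in `L²`; testing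
the weak formulation with `g` itself (`Δg = -4π²g`) gives
`⟨u(T),g⟩ - ⟨u₀,g⟩ = ∫₀ᵀ (N - 4π²ν⟨u,g⟩ + ‖g‖₂²)` with the trilinear term `N(t) = ∫⟪u,(u·∇)g⟫ → 0`
(its first-eigenspace part vanishes by parity, FMRT App. III.A.4 p. 180), so the Cesàro means of
`⟨u,g⟩` converge to `‖g‖₂²/(4π²ν)`, and `‖u‖₂² ≥ ⟨u,g⟩²/‖g‖₂² ≥ (2L⟨u,g⟩ - L²)/‖g‖₂²`. TIGHTNESS /
RIGIDITY LEMMA for the crux: at every first-shell force the admissible zero-momentum families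
have mean energy `≥ c/ν²`, whatever the data. [cite: FoiasManleyRosaTemam2001, Ch. III (3.35) and App. III.A.4] -/
theorem meanEnergy_ge_of_firstShell (hν : 0 < ν) (hg : IsSmooth g) (hgd : IsDivFree g)
    (hgm : HasZeroMean g)
    (hg1 : ∀ k : (Fin 2 → ℤ), freqNormSq k ≠ 1 → mFourierCoeff (EuclideanSpace.complexify ∘ g) k = 0)
    (hu₀ : MemLp u₀ 2 volume) (h0 : HasZeroMean u₀)
    (hu : IsGlobalLerayHopf ν (fun _ => g) u₀ u) :
    (∫ x, ‖g x‖ ^ 2) / (16 * Real.pi ^ 4 * ν ^ 2) ≤ meanEnergy u := by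
  -- notation
  set A2 : ℝ := ∫ x, ‖g x‖ ^ 2 with hA2
  set E : ℝ → ℝ := fun τ => ∫ x, ‖u τ x‖ ^ 2 with hEdef
  set Φ : ℝ → ℝ := fun s => ∫ x, ⟪u s x, g x⟫_ℝ with hΦ
  set N : ℝ → ℝ := fun s => ∫ x, ⟪u s x, convect (u s) g x⟫_ℝ with hN
  set Φ₀ : ℝ := ∫ x, ⟪u₀ x, g x⟫_ℝ with hΦ₀
  set L : ℝ := A2 / (4 * Real.pi ^ 2 * ν) with hL
  have hA2_0 : 0 ≤ A2 := integral_nonneg fun _ => sq_nonneg _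
  have hE0 : ∀ τ, 0 ≤ E τ := fun τ => integral_nonneg fun _ => sq_nonneg _
  rw [meanEnergy_eq_longTimeAvgSup]
  change A2 / (16 * Real.pi ^ 4 * ν ^ 2) ≤ longTimeAvgSup E
  rcases eq_or_lt_of_le hA2_0 with hA2z | hA2pos
  · rw [← hA2z, zero_div]
    exact longTimeAvgSup_nonneg hE0
  set M : ℝ := A2 / (16 * Real.pi ^ 4 * ν ^ 2) with hM
  have hc : 0 < 4 * Real.pi ^ 2 * ν := by positivity
  -- data of the argument
  obtain ⟨D, hD0, hD⟩ := exists_sum_norm_partialDeriv_le hg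
  obtain ⟨⟨K, hK0, hK⟩, hExc⟩ :=
    bound_and_enstrophyExcess_tendsto_zero_of_firstShell hν hg hgm hg1 hu₀ h0 hu
  have hgc : Continuous g := hg.continuous
  have hfm : ∀ T : ℝ, AEStronglyMeasurable (stLift fun _ : ℝ => g)
      (volume.restrict (Ioo 0 T ×ˢ univ)) := fun T => aestronglyMeasurable_stLift_steady hgc _
  have hf₂ : ∀ T : ℝ, ∫⁻ _ in Ioo (0 : ℝ) T, ∫⁻ x, ‖g x‖ₑ ^ 2 < ⊤ := fun T =>
    lintegral_Ioo_lintegral_enorm_sq_steady_lt_top (hg.memLp 2) T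
  -- STEP 1: the trilinear term tends to zero
  have hN0 : Tendsto N atTop (𝓝 0) := by
    have htail := tendsto_integral_norm_sq_truncate_sub hu hExc
    have hbound : ∀ᶠ τ in atTop, ‖N τ‖ ≤ 2 * D * Real.sqrt K *
        Real.sqrt (∫ x, ‖fourierTruncate 1 (u τ) x - u τ x‖ ^ 2) := by
      filter_upwards [eventually_gt_atTop 0] with τ hτ
      have hmem : MemLp (u τ) 2 volume := hu.memLp_two hτ.le
      have hz : mFourierCoeff (EuclideanSpace.complexify ∘ u τ) 0 = 0 :=
        mFourierCoeff_zero_of_hasZeroMean (hmem.integrable one_le_two)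
          (hasZeroMean_slice hg hgm hu₀ h0 hu hτ)
      rw [Real.norm_eq_abs]
      exact abs_integral_inner_convect_firstShell_le_sqrt hmem hz hgc hg1 hD (hK τ hτ)
    have hlim : Tendsto (fun τ => 2 * D * Real.sqrt K *
        Real.sqrt (∫ x, ‖fourierTruncate 1 (u τ) x - u τ x‖ ^ 2)) atTop (𝓝 0) := by
      have h := ((Real.continuous_sqrt.tendsto 0).comp htail).const_mul (2 * D * Real.sqrt K)
      simpa using h
    exact squeeze_zero_norm' hbound hlim
  -- STEP 2: integrability of `Φ`, `N` on every `(0, T]`, and the sliced identity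
  have hΦint : ∀ T, 0 < T → IntegrableOn Φ (Ioc 0 T) := fun T hT =>
    (integrableOn_Ioc_iff_integrableOn_Ioo).2 ((hu T hT).integrableOn_integral_inner hgc)
  have hflux_eq : ∀ s, 0 < s →
      (∫ x, (⟪u s x, convect (u s) g x⟫_ℝ + ν * ⟪u s x, laplacian g x⟫_ℝ + ⟪g x, g x⟫_ℝ)) =
        N s + (-(4 * Real.pi ^ 2 * ν)) * Φ s + A2 := by
    intro s hs
    have hmem : MemLp (u s) 2 volume := hu.memLp_two hs.le
    have i1 : Integrable (fun x => ⟪u s x, convect (u s) g x⟫_ℝ) volume :=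
      integrable_inner_convect_self hmem hg
    have i2 : Integrable (fun x => ⟪u s x, laplacian g x⟫_ℝ) volume :=
      integrable_inner_of_continuous (hmem.integrable one_le_two) hg.laplacian.continuous
    have i3 : Integrable (fun x => ⟪g x, g x⟫_ℝ) volume :=
      integrable_inner_of_continuous hg.integrable hgc
    have i12 : Integrable (fun x => ⟪u s x, convect (u s) g x⟫_ℝ + ν * ⟪u s x, laplacian g x⟫_ℝ)
        volume := i1.add (i2.const_mul ν)
    have hlap : ∫ x, ⟪u s x, laplacian g x⟫_ℝ = -(4 * Real.pi ^ 2) * Φ s := by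
      simp only [hΦ]
      rw [← integral_const_mul]
      refine integral_congr_ae (ae_of_all _ fun x => ?_)
      show ⟪u s x, laplacian g x⟫_ℝ = -(4 * Real.pi ^ 2) * ⟪u s x, g x⟫_ℝ
      rw [laplacian_of_firstShell hgc hg1 x, inner_smul_right]
    have hgg : ∫ x, ⟪g x, g x⟫_ℝ = A2 := by
      simp only [hA2]
      exact integral_congr_ae (ae_of_all _ fun x => real_inner_self_eq_norm_sq _)
    rw [integral_add i12 i3, integral_add i1 (i2.const_mul ν), integral_const_mul, hlap, hgg]
    simp only [hN]
    ring
  have hNint : ∀ T, 0 < T → IntegrableOn N (Ioc 0 T) := by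
    intro T hT
    have hfluxInt : IntegrableOn (fun s => ∫ x, (⟪u s x, convect (u s) g x⟫_ℝ +
        ν * ⟪u s x, laplacian g x⟫_ℝ + ⟪g x, g x⟫_ℝ)) (Ioc 0 T) :=
      (integrableOn_Ioc_iff_integrableOn_Ioo).2 ((hu T hT).integrableOn_flux (hfm T) (hf₂ T) hg)
    have hconstInt : IntegrableOn (fun _ : ℝ => A2) (Ioc 0 T) :=
      integrableOn_const (hs := measure_Ioc_lt_top.ne)
    refine ((hfluxInt.add ((hΦint T hT).const_mul (4 * Real.pi ^ 2 * ν))).sub hconstInt).congr_fun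
      (fun s hs => ?_) measurableSet_Ioc
    simp only [Pi.add_apply, Pi.sub_apply]
    rw [hflux_eq s hs.1]
    ring
  have hid : ∀ T, 0 < T → Φ T = Φ₀ + (∫ s in Ioc 0 T, N s) -
      4 * Real.pi ^ 2 * ν * (∫ s in Ioc 0 T, Φ s) + A2 * T := by
    intro T hT
    have h1 : Φ T = Φ₀ + ∫ s in Ioc 0 T,
        ∫ x, (⟪u s x, convect (u s) g x⟫_ℝ + ν * ⟪u s x, laplacian g x⟫_ℝ + ⟪g x, g x⟫_ℝ) :=
      (hu T hT).integral_inner_eq_add_setIntegral hT (hfm T) (hf₂ T) hg hgd ⟨hT, le_rfl⟩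
    have hconstInt : IntegrableOn (fun _ : ℝ => A2) (Ioc 0 T) :=
      integrableOn_const (hs := measure_Ioc_lt_top.ne)
    have hNI := hNint T hT
    have hΦI := hΦint T hT
    have hNΦ : IntegrableOn (fun s => N s + (-(4 * Real.pi ^ 2 * ν)) * Φ s) (Ioc 0 T) :=
      hNI.add (hΦI.const_mul _)
    rw [h1, setIntegral_congr_fun measurableSet_Ioc (fun s hs => hflux_eq s hs.1),
      integral_add hNΦ hconstInt, integral_add hNI (hΦI.const_mul _),
      integral_const_mul, setIntegral_const, Real.volume_real_Ioc_of_le hT.le, sub_zero, smul_eq_mul]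
    ring
  -- STEP 3: the Cesàro means of `Φ` converge to `L = A2/(4π²ν)`
  set R : ℝ → ℝ := fun T => (A2 + timeMean N T + T⁻¹ * (Φ₀ - Φ T)) / (4 * Real.pi ^ 2 * ν) with hR
  have htm : ∀ T, 0 < T → timeMean Φ T = R T := by
    intro T hT
    have h := hid T hT
    have hI : (∫ s in Ioc 0 T, Φ s) =
        (Φ₀ + (∫ s in Ioc 0 T, N s) + A2 * T - Φ T) / (4 * Real.pi ^ 2 * ν) := by
      rw [eq_div_iff hc.ne']
      linarith
    simp only [hR, timeMean]
    rw [intervalIntegral.integral_of_le hT.le, intervalIntegral.integral_of_le hT.le, hI]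
    field_simp
    ring
  have hB : ∀ T, 0 < T → |Φ T| ≤ Real.sqrt K * Real.sqrt A2 := by
    intro T hT
    have h1 : |Φ T| ≤ Real.sqrt (E T) * Real.sqrt A2 :=
      abs_integral_inner_le_sqrt_mul_sqrt (hu.memLp_two hT.le) (hg.memLp 2)
    exact h1.trans (mul_le_mul_of_nonneg_right (Real.sqrt_le_sqrt (hK T hT)) (Real.sqrt_nonneg _))
  have hbdry : Tendsto (fun T : ℝ => T⁻¹ * (Φ₀ - Φ T)) atTop (𝓝 0) := by
    have hb : ∀ᶠ T in atTop, ‖T⁻¹ * (Φ₀ - Φ T)‖ ≤ (|Φ₀| + Real.sqrt K * Real.sqrt A2) * T⁻¹ := by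
      filter_upwards [eventually_gt_atTop 0] with T hT
      rw [Real.norm_eq_abs, abs_mul, abs_inv, abs_of_pos hT, mul_comm]
      refine mul_le_mul_of_nonneg_right ((abs_sub _ _).trans (add_le_add le_rfl (hB T hT))) ?_
      positivity
    have hl : Tendsto (fun T : ℝ => (|Φ₀| + Real.sqrt K * Real.sqrt A2) * T⁻¹) atTop (𝓝 0) := by
      simpa using tendsto_inv_atTop_zero.const_mul (|Φ₀| + Real.sqrt K * Real.sqrt A2)
    exact squeeze_zero_norm' hb hl
  have hNmean : Tendsto (timeMean N) atTop (𝓝 0) := tendsto_timeMean_of_tendsto hNint hN0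
  have hRL : Tendsto R atTop (𝓝 L) := by
    have h := ((tendsto_const_nhds (x := A2)).add hNmean).add hbdry
    have h2 := h.div_const (4 * Real.pi ^ 2 * ν)
    rw [add_zero, add_zero] at h2
    exact h2
  -- STEP 4: the energy dominates `(2LΦ - L²)/A2` pointwise, hence in Cesàro mean
  have hlowpt : ∀ τ, 0 < τ → (2 * L * Φ τ - L ^ 2) / A2 ≤ E τ := by
    intro τ hτ
    have hcs : |Φ τ| ≤ Real.sqrt (E τ) * Real.sqrt A2 :=
      abs_integral_inner_le_sqrt_mul_sqrt (hu.memLp_two hτ.le) (hg.memLp 2)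
    have hsq : Φ τ ^ 2 ≤ E τ * A2 := by
      rw [← sq_abs]
      calc |Φ τ| ^ 2 ≤ (Real.sqrt (E τ) * Real.sqrt A2) ^ 2 := pow_le_pow_left₀ (abs_nonneg _) hcs 2
        _ = E τ * A2 := by rw [mul_pow, Real.sq_sqrt (hE0 τ), Real.sq_sqrt hA2_0]
    rw [div_le_iff₀ hA2pos]
    nlinarith [sq_nonneg (Φ τ - L)]
  have hlowmean : ∀ T, 0 < T → (2 * L * timeMean Φ T - L ^ 2) / A2 ≤ timeMean E T := by
    intro T hT
    have hΦI := hΦint T hT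
    have hEint : IntegrableOn E (Ioc 0 T) := hu.integrableOn_integral_norm_sq hT
    have hconstInt : IntegrableOn (fun _ : ℝ => L ^ 2) (Ioc 0 T) :=
      integrableOn_const (hs := measure_Ioc_lt_top.ne)
    have hl : IntegrableOn (fun s => (2 * L * Φ s - L ^ 2) / A2) (Ioc 0 T) :=
      ((hΦI.const_mul (2 * L)).sub hconstInt).div_const A2
    have hmono := setIntegral_mono_on hl hEint measurableSet_Ioc fun s hs => hlowpt s hs.1
    have hcomp : ∫ s in Ioc 0 T, (2 * L * Φ s - L ^ 2) / A2 =
        (2 * L * (∫ s in Ioc 0 T, Φ s) - L ^ 2 * T) / A2 := by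
      rw [integral_div, integral_sub (hΦI.const_mul _) hconstInt, integral_const_mul,
        setIntegral_const, Real.volume_real_Ioc_of_le hT.le, sub_zero, smul_eq_mul]
      ring
    rw [hcomp] at hmono
    simp only [timeMean]
    rw [intervalIntegral.integral_of_le hT.le, intervalIntegral.integral_of_le hT.le]
    have hTi : 0 < T⁻¹ := inv_pos.2 hT
    have h2 := mul_le_mul_of_nonneg_left hmono hTi.le
    have heq : T⁻¹ * ((2 * L * (∫ s in Ioc 0 T, Φ s) - L ^ 2 * T) / A2) =
        (2 * L * (T⁻¹ * ∫ s in Ioc 0 T, Φ s) - L ^ 2) / A2 := by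
      field_simp
    rw [heq] at h2
    exact h2
  -- STEP 5: pass to the `limsup`
  set lowF : ℝ → ℝ := fun T => (2 * L * R T - L ^ 2) / A2 with hlowF
  have hle : ∀ᶠ T in atTop, lowF T ≤ timeMean E T := by
    filter_upwards [eventually_gt_atTop 0] with T hT
    simp only [hlowF]
    rw [← htm T hT]
    exact hlowmean T hT
  have hM' : (2 * L * L - L ^ 2) / A2 = M := by
    rw [hL, hM]
    field_simp
    ring
  have hlow : Tendsto lowF atTop (𝓝 M) := by
    have h := ((hRL.const_mul (2 * L)).sub (tendsto_const_nhds (x := L ^ 2))).div_const A2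
    rw [hM'] at h
    exact h
  have hbdd : IsBoundedUnder (· ≤ ·) atTop (timeMean E) :=
    ⟨_, (eventually_ge_atTop (1 : ℝ)).mono fun T hT => hu.timeMean_norm_sq_le hν hg hgm hT⟩
  rw [longTimeAvgSup]
  calc M = limsup lowF atTop := hlow.limsup_eq.symm
    _ ≤ limsup (timeMean E) atTop := limsup_le_limsup hle hlow.isCoboundedUnder_le hbdd

end Main

/-! ### Refutations: the crux at ANY first-shell force; witnesses need a mode with `|k|² ≥ 2` -/

section Refutations

/-- **The crux restricted to first-shell forces is FALSE — for the whole first eigenspace.**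
It is NOT the case that some smooth, divergence-free, mean-zero `g ≠ 0` on `(UnitAddTorus (Fin 2))` WITH FOURIER
SUPPORT ON THE FIRST SHELL `|k|² = 1` (any of the 4-dimensional first Stokes eigenspace:
`a cos 2πx₀ e₁ + b sin 2πx₀ e₁ + c cos 2πx₁ e₀ + d sin 2πx₁ e₀`, crossed cellular forces
included) admits, along viscosities `ν_j → 0⁺`, zero-momentum `L²` data and global Leray–Hopf
solutions with bounded mean energy: by `meanEnergy_ge_of_firstShell`,
`⟨‖v_j‖²⟩ ≥ ‖g‖₂²/(16π⁴ν_j²) → ∞`. This is the crux `TwoAndHalfD.TwodBoundedEnergyZeroMomentum`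
with ONE extra conjunct (the Fourier-support clause); it supersedes the single-pair case
`not_TwodBoundedEnergyZeroMomentum_firstMode` (Marchioro 1986; FMRT 2001 Ch. III (3.35)).
Consequence for provers: a witness force MUST have a non-zero Fourier mode with `|k|² ≥ 2`
(`exists_mode_two_le_of_witness`). [cite: FoiasManleyRosaTemam2001, Ch. III (3.35) and App. III.A.4] -/
theorem not_TwodBoundedEnergyZeroMomentum_firstShell :
    ¬ ∃ g : (UnitAddTorus (Fin 2)) → (EuclideanSpace ℝ (Fin 2)), IsSmooth g ∧ IsDivFree g ∧ HasZeroMean g ∧ g ≠ 0 ∧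
      (∀ k : (Fin 2 → ℤ), freqNormSq k ≠ 1 → mFourierCoeff (EuclideanSpace.complexify ∘ g) k = 0) ∧
      ∃ (ν : ℕ → ℝ) (v₀ : ℕ → (UnitAddTorus (Fin 2)) → (EuclideanSpace ℝ (Fin 2))) (v : ℕ → ℝ → (UnitAddTorus (Fin 2)) → (EuclideanSpace ℝ (Fin 2))),
        (∀ j, 0 < ν j) ∧ Tendsto ν atTop (𝓝 0) ∧
        (∀ j, MemLp (v₀ j) 2 volume ∧ HasZeroMean (v₀ j)) ∧
        (∀ j, IsGlobalLerayHopf (ν j) (fun _ => g) (v₀ j) (v j)) ∧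
        ∃ E : ℝ, ∀ j, meanEnergy (v j) ≤ E := by
  rintro ⟨g, hg, hgd, hgm, hg0, hg1, ν, v₀, v, hν, hν0, hdata, hLH, E, hE⟩
  set A2 : ℝ := ∫ x, ‖g x‖ ^ 2 with hA2def
  have hA2 : 0 < A2 := integral_norm_sq_pos_of_firstShell hg.continuous hg1 hg0
  have hEj : ∀ j, A2 / (16 * Real.pi ^ 4 * ν j ^ 2) ≤ E := fun j =>
    (meanEnergy_ge_of_firstShell (hν j) hg hgd hgm hg1 (hdata j).1 (hdata j).2 (hLH j)).trans (hE j)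
  have hE0 : 0 < E := by
    have h0 : 0 < A2 / (16 * Real.pi ^ 4 * ν 0 ^ 2) := by
      have := hν 0
      positivity
    exact h0.trans_le (hEj 0)
  -- `ν_j² ≥ A2/(16π⁴E)` contradicts `ν_j → 0`
  have hlow : ∀ j, A2 / (16 * Real.pi ^ 4 * E) ≤ ν j ^ 2 := fun j => by
    have h1 := hEj j
    have hνj := hν j
    rw [div_le_iff₀ (by positivity)] at h1
    rw [div_le_iff₀ (by positivity)]
    nlinarith
  have hsq : Tendsto (fun j => ν j ^ 2) atTop (𝓝 0) := by
    simpa using hν0.pow 2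
  have hc : 0 < A2 / (16 * Real.pi ^ 4 * E) := by positivity
  have hev := (tendsto_order.1 hsq).2 _ hc
  obtain ⟨j, hj⟩ := hev.exists
  exact absurd (hlow j) (not_le.2 hj)

/-- **Every witness force of the crux carries a Fourier mode with `|k|² ≥ 2`.** If a smooth,
divergence-free, mean-zero `g ≠ 0` admits a zero-momentum bounded-mean-energy Leray–Hopf family
along `ν_j → 0⁺` (i.e. `g` witnesses `TwoAndHalfD.TwodBoundedEnergyZeroMomentum`), then
`ĝ(k) ≠ 0` for some frequency `k` with `|k|² ≥ 2`: the forcing must reach beyond the first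
Stokes eigenspace (design constraint for provers; the first shell is rigid by
`not_TwodBoundedEnergyZeroMomentum_firstShell`, and `ĝ(0) = 0` by zero mean). [folklore] -/
theorem exists_mode_two_le_of_witness {g : (UnitAddTorus (Fin 2)) → (EuclideanSpace ℝ (Fin 2))} (hg : IsSmooth g) (hgd : IsDivFree g)
    (hgm : HasZeroMean g) (hg0 : g ≠ 0) {ν : ℕ → ℝ} {v₀ : ℕ → (UnitAddTorus (Fin 2)) → (EuclideanSpace ℝ (Fin 2))}
    {v : ℕ → ℝ → (UnitAddTorus (Fin 2)) → (EuclideanSpace ℝ (Fin 2))} (hν : ∀ j, 0 < ν j) (hν0 : Tendsto ν atTop (𝓝 0))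
    (hdata : ∀ j, MemLp (v₀ j) 2 volume ∧ HasZeroMean (v₀ j))
    (hLH : ∀ j, IsGlobalLerayHopf (ν j) (fun _ => g) (v₀ j) (v j)) {E : ℝ}
    (hE : ∀ j, meanEnergy (v j) ≤ E) :
    ∃ k : (Fin 2 → ℤ), 2 ≤ freqNormSq k ∧ mFourierCoeff (EuclideanSpace.complexify ∘ g) k ≠ 0 := by
  by_contra h
  push Not at h
  have hg1 : ∀ k : (Fin 2 → ℤ), freqNormSq k ≠ 1 → mFourierCoeff (EuclideanSpace.complexify ∘ g) k = 0 := by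
    intro k hk
    by_cases hk0 : k = 0
    · subst hk0
      exact mFourierCoeff_zero_of_hasZeroMean hg.integrable hgm
    · exact h k (two_le_freqNormSq_of_one_lt (lt_of_le_of_ne
        (Literature.Analysis.FluidPDE.one_le_freqNormSq_of_ne_zero hk0) (Ne.symm hk)))
  exact not_TwodBoundedEnergyZeroMomentum_firstShell
    ⟨g, hg, hgd, hgm, hg0, hg1, ν, v₀, v, hν, hν0, hdata, hLH, E, hE⟩

/-! ### Steady states (the sub-class every round-1 crux idea uses) -/

/-- The mean energy of a steady path is its energy. [folklore] -/
theorem meanEnergy_const (v : (UnitAddTorus (Fin 2)) → (EuclideanSpace ℝ (Fin 2))) : meanEnergy (fun _ : ℝ => v) = ∫ x, ‖v x‖ ^ 2 := by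
  rw [meanEnergy_eq_longTimeAvgSup]
  exact longTimeAvgSup_eq_of_tendsto (fun T _ => integrableOn_const (hs := measure_Ioc_lt_top.ne))
    tendsto_const_nhds

/-- **No steady zero-momentum state under a first-shell force lies below the laminar energy.**
For a smooth steady state `v` (pressure `p`) of `NS_ν(g)` on `(UnitAddTorus (Fin 2))` (`Torus.IsSteadyNSState`) with
zero mean, `ν > 0`, and a smooth divergence-free mean-zero first-shell force `g`:
`∫ ‖v‖² ≥ ‖g‖₂²/(16π⁴ν²)` — a steady state is a global Leray–Hopf solution from its own datum
(`IsClassicalNSSolutionOn.isGlobalLerayHopf`) with `meanEnergy = ∫ ‖v‖²`. [folklore] -/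
theorem integral_norm_sq_ge_of_steady_firstShell {ν : ℝ} {g : (UnitAddTorus (Fin 2)) → (EuclideanSpace ℝ (Fin 2))} (hν : 0 < ν)
    (hg : IsSmooth g) (hgd : IsDivFree g) (hgm : HasZeroMean g)
    (hg1 : ∀ k : (Fin 2 → ℤ), freqNormSq k ≠ 1 → mFourierCoeff (EuclideanSpace.complexify ∘ g) k = 0)
    {v : (UnitAddTorus (Fin 2)) → (EuclideanSpace ℝ (Fin 2))} {p : (UnitAddTorus (Fin 2)) → ℝ} (hv : IsSteadyNSState ν g v p) (hvm : HasZeroMean v) :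
    (∫ x, ‖g x‖ ^ 2) / (16 * Real.pi ^ 4 * ν ^ 2) ≤ ∫ x, ‖v x‖ ^ 2 := by
  have hLH : IsGlobalLerayHopf ν (fun _ => g) v (fun _ => v) := hv.isGlobalLerayHopf
  have hmem : MemLp v 2 volume := hLH.memLp_two le_rfl
  rw [← meanEnergy_const v]
  exact meanEnergy_ge_of_firstShell hν hg hgd hgm hg1 hmem hvm hLH

/-- **No bounded steady branch under a first-shell force** (the steady sub-case of the crux that
every round-1 idea card — internal-galilean-jets, detuned-shear-steady-branch,
parity-protected-swept-condensate, bilinear-euler-orbit-selection, forced-euler-anchor — aims at,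
with the first-shell clause added): there is NO smooth divergence-free mean-zero first-shell
`g ≠ 0` with zero-mean steady states `v_j` of `NS_{ν_j}(g)`, `ν_j → 0⁺`, of bounded energy. [folklore] -/
theorem not_boundedSteadyBranch_firstShell :
    ¬ ∃ g : (UnitAddTorus (Fin 2)) → (EuclideanSpace ℝ (Fin 2)), IsSmooth g ∧ IsDivFree g ∧ HasZeroMean g ∧ g ≠ 0 ∧
      (∀ k : (Fin 2 → ℤ), freqNormSq k ≠ 1 → mFourierCoeff (EuclideanSpace.complexify ∘ g) k = 0) ∧
      ∃ (ν : ℕ → ℝ) (v : ℕ → (UnitAddTorus (Fin 2)) → (EuclideanSpace ℝ (Fin 2))) (p : ℕ → (UnitAddTorus (Fin 2)) → ℝ),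
        (∀ j, 0 < ν j) ∧ Tendsto ν atTop (𝓝 0) ∧
        (∀ j, IsSteadyNSState (ν j) g (v j) (p j)) ∧ (∀ j, HasZeroMean (v j)) ∧
        ∃ E : ℝ, ∀ j, ∫ x, ‖v j x‖ ^ 2 ≤ E := by
  rintro ⟨g, hg, hgd, hgm, hg0, hg1, ν, v, p, hν, hν0, hst, hvm, E, hE⟩
  have hLH : ∀ j, IsGlobalLerayHopf (ν j) (fun _ => g) (v j) (fun _ => v j) := fun j =>
    (hst j).isGlobalLerayHopf
  refine not_TwodBoundedEnergyZeroMomentum_firstShell ⟨g, hg, hgd, hgm, hg0, hg1, ν, v,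
    fun j _ => v j, hν, hν0, fun j => ⟨(hLH j).memLp_two le_rfl, hvm j⟩, hLH, E, fun j => ?_⟩
  rw [meanEnergy_const]
  exact hE j

end Refutations

end Summit.AnomalousDissipation.AnomalousDissipation.Theorems.TwodBoundedEnergyZeroMomentum.Negative

end
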